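import Mathlib
import Literature.Analysis.FluidPDE.GaussianVortexPlanar
import Literature.Analysis.FluidPDE.GaussianVortexPlanarProofs
import Literature.Analysis.FluidPDE.BiotSavart2DSymmetry
import Summits.AnomalousDissipation.AnomalousDissipation.Theorems.MarginalStabilityChainStretchedVortexRowsStubCoreRotationLocalSkew
import Summits.AnomalousDissipation.AnomalousDissipation.Theorems.MarginalStabilityChainStretchedVortexRowsStubBiotSavartFarField
import Summits.AnomalousDissipation.AnomalousDissipation.Theorems.MarginalStabilityChainStretchedVortexRowsStubWeakDivFreeGaussClass
import HarnessLib

/-!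
# Helper toward stub `stub_coreInverse` of the line `braid-closed-large-circulation-gluing`
# (crux stmt-AnomalousDissipation-3009, `MarginalStabilityChain.StretchedVortexRows`):
# the radial component of a Biot–Savart velocity integrates to zero against radial Gaussian weights

For a Gaussian-class density `w_B` with velocity `u_B = K∗w_B` and a RADIAL continuous bounded `q`,
  `∫ G(ξ) q(ξ) ⟪ξ, u_B(ξ)⟫ dξ = 0`                                   (`integral_gauss_radial_mul_inner_id_biotSavart2D_eq_zero`).
Proof: the radial vector field `G q ξ` is a gradient, `G(ξ)q(ξ)ξ = ∇H(ξ)` with `H(ξ) = Φ(|ξ|²/2)`,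
`Φ(τ) = −∫_τ^∞ (4π)⁻¹e^{−σ/2} q̂(σ) dσ` (`q̂` the radial profile of `q` in the variable `τ = |ξ|²/2`), a `C¹` function of
Gaussian class (`|H| ≤ 2QG`, `‖∇H‖ ≤ Q|ξ|G`), so the integral is `∫⟪u_B, ∇H⟫ = 0` by the weak divergence-freeness of
`u_B` against Gaussian-class test functions (`integral_inner_biotSavart2D_gradient_eq_zero_of_gaussClass`). Equivalently:
the flux `∮ u_B·n` through every circle vanishes. Used for the `(u₀, u₀)` block of the background potential term
`−¼∫Gu²(ξ·u_B)` in `lamB_pairing_w_bound` (`q = u₀²`).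
-/

set_option linter.dupNamespace false

noncomputable section

open scoped RealInnerProductSpace Topology
open MeasureTheory WithLp Function Metric Filter Set

namespace Summit.AnomalousDissipation.AnomalousDissipation.Theorems.MarginalStabilityChainStretchedVortexRows

open Literature.Analysis.FluidPDE

/-- **Radial weights see no flux**: `∫ G q ⟪ξ, K∗w_B⟫ = 0` for radial continuous bounded `q` and Gaussian-class `w_B`. [folklore] -/
theorem integral_gauss_radial_mul_inner_id_biotSavart2D_eq_zero :
    ∀ (k : ℕ) (C_B Q : ℝ) (wB q : EuclideanSpace ℝ (Fin 2) → ℝ), Continuous wB →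
      (∀ ξ, |wB ξ| ≤ C_B * (1 + ‖ξ‖) ^ k * gaussVortexProfile ξ) →
      Continuous q → (∀ ξ η : EuclideanSpace ℝ (Fin 2), ‖ξ‖ = ‖η‖ → q ξ = q η) → (∀ ξ, |q ξ| ≤ Q) →
      ∫ ξ, gaussVortexProfile ξ * q ξ * ⟪ξ, biotSavart2D wB ξ⟫ = 0 := by
  intro k C_B Q wB q hwBc hwBb hqc hrad hQ
  have hQ0 : 0 ≤ Q := (abs_nonneg _).trans (hQ 0)
  have hGpos : ∀ ξ : EuclideanSpace ℝ (Fin 2), 0 < gaussVortexProfile ξ := gaussVortexProfile_pos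
  have hpi : 0 < (4 * Real.pi)⁻¹ := by positivity
  -- `w_B` is bounded and integrable
  obtain ⟨Bk, hBk0, hBk⟩ := exists_bound_one_add_norm_pow_mul_gaussVortexProfile k
  have hwBabs : ∀ ξ, |wB ξ| ≤ |C_B| * Bk := by
    intro ξ
    calc |wB ξ| ≤ C_B * (1 + ‖ξ‖) ^ k * gaussVortexProfile ξ := hwBb ξ
      _ ≤ |C_B| * ((1 + ‖ξ‖) ^ k * gaussVortexProfile ξ) := by
          rw [mul_assoc]; exact mul_le_mul_of_nonneg_right (le_abs_self _) (by positivity [hGpos ξ])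
      _ ≤ |C_B| * Bk := mul_le_mul_of_nonneg_left (hBk ξ) (abs_nonneg _)
  have hwBi : Integrable wB := by
    refine integrable_of_le_one_add_norm_pow_mul_gauss hwBc (A := |C_B|) (N := k) (fun ξ => ?_)
    rw [Real.norm_eq_abs]
    calc |wB ξ| ≤ C_B * (1 + ‖ξ‖) ^ k * gaussVortexProfile ξ := hwBb ξ
      _ ≤ |C_B| * ((1 + ‖ξ‖) ^ k * gaussVortexProfile ξ) := by
          rw [mul_assoc]; exact mul_le_mul_of_nonneg_right (le_abs_self _) (by positivity [hGpos ξ])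
  -- the radial profile of `q` in the variable `τ = |ξ|²/2`
  set e₀ : EuclideanSpace ℝ (Fin 2) := EuclideanSpace.single 0 1 with he₀
  have he₀n : ‖e₀‖ = 1 := by rw [he₀, PiLp.norm_single, norm_one]
  set qh : ℝ → ℝ := fun σ => q (Real.sqrt (2 * σ) • e₀) with hqh
  have hqhc : Continuous qh :=
    hqc.comp ((Real.continuous_sqrt.comp (continuous_const.mul continuous_id)).smul continuous_const)
  have hqh_eq : ∀ ξ : EuclideanSpace ℝ (Fin 2), q ξ = qh (‖ξ‖ ^ 2 / 2) := by
    intro ξ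
    refine hrad ξ _ ?_
    rw [norm_smul, he₀n, mul_one, Real.norm_eq_abs, abs_of_nonneg (Real.sqrt_nonneg _),
      show 2 * (‖ξ‖ ^ 2 / 2) = ‖ξ‖ ^ 2 by ring, Real.sqrt_sq (norm_nonneg _)]
  have hqhb : ∀ σ, |qh σ| ≤ Q := fun σ => hQ _
  -- the integrand of the primitive: `ρ̂(σ) = (4π)⁻¹ e^{−σ/2} q̂(σ)`
  set ρh : ℝ → ℝ := fun σ => (4 * Real.pi)⁻¹ * Real.exp (-σ / 2) * qh σ with hρh
  have hρhc : Continuous ρh :=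
    (continuous_const.mul (Real.continuous_exp.comp (continuous_neg.div_const 2))).mul hqhc
  have hρhb : ∀ σ, |ρh σ| ≤ (4 * Real.pi)⁻¹ * Q * Real.exp (-σ / 2) := by
    intro σ
    show |(4 * Real.pi)⁻¹ * Real.exp (-σ / 2) * qh σ| ≤ _
    rw [abs_mul, abs_mul, abs_of_pos hpi, abs_of_pos (Real.exp_pos _),
      show (4 * Real.pi)⁻¹ * Q * Real.exp (-σ / 2) = (4 * Real.pi)⁻¹ * Real.exp (-σ / 2) * Q by ring]
    exact mul_le_mul_of_nonneg_left (hqhb σ) (by positivity)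
  have hexpi : ∀ τ : ℝ, IntegrableOn (fun σ : ℝ => Real.exp (-σ / 2)) (Ioi τ) := by
    intro τ
    have h : IntegrableOn (fun σ : ℝ => Real.exp (-(1 / 2) * σ)) (Ioi τ) :=
      exp_neg_integrableOn_Ioi τ (by norm_num : (0:ℝ) < 1 / 2)
    refine h.congr_fun (fun σ _ => ?_) measurableSet_Ioi
    show Real.exp (-(1 / 2) * σ) = Real.exp (-σ / 2)
    rw [show -(1 / 2) * σ = -σ / 2 by ring]
  have hmajI : ∀ τ : ℝ, IntegrableOn (fun σ => (4 * Real.pi)⁻¹ * Q * Real.exp (-σ / 2)) (Ioi τ) := fun τ =>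
    (hexpi τ).const_mul ((4 * Real.pi)⁻¹ * Q)
  have hρhi : ∀ τ : ℝ, IntegrableOn ρh (Ioi τ) := by
    intro τ
    refine Integrable.mono' (hmajI τ) hρhc.aestronglyMeasurable (Eventually.of_forall fun σ => ?_)
    rw [Real.norm_eq_abs]
    exact hρhb σ
  have htail : ∀ τ : ℝ, ∫ σ in Ioi τ, Real.exp (-σ / 2) = 2 * Real.exp (-τ / 2) := by
    intro τ
    have h := integral_exp_mul_Ioi (a := -(1 / 2)) (by norm_num) τ
    have e : (fun σ : ℝ => Real.exp (-(1 / 2) * σ)) = fun σ => Real.exp (-σ / 2) := by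
      funext σ; congr 1; ring
    rw [e] at h
    rw [h, show -(1 / 2) * τ = -τ / 2 by ring]
    ring
  -- the primitive `Φ(τ) = ∫₀^τ ρ̂ − ∫₀^∞ ρ̂ = −∫_τ^∞ ρ̂`
  set I : ℝ := ∫ σ in Ioi 0, ρh σ with hI
  set Φ : ℝ → ℝ := fun τ => (∫ σ in (0:ℝ)..τ, ρh σ) - I with hΦ
  have hΦd : ∀ τ, HasDerivAt Φ (ρh τ) τ := by
    intro τ
    have h := intervalIntegral.integral_hasDerivAt_right (hρhc.intervalIntegrable 0 τ)
      hρhc.aestronglyMeasurable.stronglyMeasurableAtFilter hρhc.continuousAt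
    exact h.sub_const I
  have hΦtail : ∀ τ, Φ τ = -∫ σ in Ioi τ, ρh σ := by
    intro τ
    have h := intervalIntegral.integral_interval_add_Ioi (hρhi 0) (hρhi τ)
    rw [hΦ]; dsimp only; rw [hI]; linarith
  have hΦb : ∀ τ, |Φ τ| ≤ 2 * ((4 * Real.pi)⁻¹ * Q) * Real.exp (-τ / 2) := by
    intro τ
    rw [hΦtail, abs_neg]
    calc |∫ σ in Ioi τ, ρh σ| ≤ ∫ σ in Ioi τ, |ρh σ| := by
          simpa only [← Real.norm_eq_abs] using norm_integral_le_integral_norm _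
      _ ≤ ∫ σ in Ioi τ, (4 * Real.pi)⁻¹ * Q * Real.exp (-σ / 2) := by
          exact setIntegral_mono_on (hρhi τ).abs (hmajI τ) measurableSet_Ioi (fun σ _ => hρhb σ)
      _ = (4 * Real.pi)⁻¹ * Q * ∫ σ in Ioi τ, Real.exp (-σ / 2) := integral_const_mul _ _
      _ = 2 * ((4 * Real.pi)⁻¹ * Q) * Real.exp (-τ / 2) := by rw [htail]; ring
  -- `Φ` is `C¹`
  have hΦ1 : ContDiff ℝ 1 Φ := by
    rw [contDiff_one_iff_deriv]
    refine ⟨fun τ => (hΦd τ).differentiableAt, ?_⟩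
    have : deriv Φ = ρh := funext fun τ => (hΦd τ).deriv
    rw [this]; exact hρhc
  -- the potential `H(ξ) = Φ(|ξ|²/2)`: `C¹`, with `DH(ξ) = ρ̂(|ξ|²/2) ⟪ξ, ·⟫`
  set H : EuclideanSpace ℝ (Fin 2) → ℝ := fun ξ => Φ (‖ξ‖ ^ 2 / 2) with hH
  have hτ : ∀ ξ : EuclideanSpace ℝ (Fin 2), HasFDerivAt (fun ξ : EuclideanSpace ℝ (Fin 2) => ‖ξ‖ ^ 2 / 2)
      (innerSL ℝ ξ) ξ := by
    intro ξ
    have h := ((hasStrictFDerivAt_norm_sq ξ).hasFDerivAt).const_mul (1 / 2 : ℝ)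
    have hfun : (fun ξ : EuclideanSpace ℝ (Fin 2) => ‖ξ‖ ^ 2 / 2) = fun ξ => (1 / 2 : ℝ) * ‖ξ‖ ^ 2 := by
      funext ξ; ring
    rw [hfun]
    refine h.congr_fderiv ?_
    ext v
    simp [two_smul]
    ring
  have hτs : ContDiff ℝ 1 (fun ξ : EuclideanSpace ℝ (Fin 2) => ‖ξ‖ ^ 2 / 2) := (contDiff_norm_sq ℝ).div_const 2
  have hH1 : ContDiff ℝ 1 H := hΦ1.comp hτs
  have hHd : ∀ ξ, HasFDerivAt H (ρh (‖ξ‖ ^ 2 / 2) • innerSL ℝ ξ) ξ := fun ξ => by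
    have := (hΦd (‖ξ‖ ^ 2 / 2)).comp_hasFDerivAt ξ (hτ ξ)
    exact this
  -- `ρ̂(|ξ|²/2) = G(ξ) q(ξ)`
  have hρh_eq : ∀ ξ : EuclideanSpace ℝ (Fin 2), ρh (‖ξ‖ ^ 2 / 2) = gaussVortexProfile ξ * q ξ := by
    intro ξ
    rw [hρh]; dsimp only
    rw [hqh_eq ξ, gaussVortexProfile, show -(‖ξ‖ ^ 2 / 2) / 2 = -(‖ξ‖ ^ 2 / 4) by ring]
  -- Gaussian-class bounds for `H`
  have hHb : ∀ ξ, |H ξ| + ‖fderiv ℝ H ξ‖ ≤ 3 * Q * (1 + ‖ξ‖) ^ 1 * gaussVortexProfile ξ := by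
    intro ξ
    have hG := hGpos ξ
    have h1 : |H ξ| ≤ 2 * Q * gaussVortexProfile ξ := by
      have := hΦb (‖ξ‖ ^ 2 / 2)
      rw [show -(‖ξ‖ ^ 2 / 2) / 2 = -(‖ξ‖ ^ 2 / 4) by ring] at this
      calc |H ξ| = |Φ (‖ξ‖ ^ 2 / 2)| := rfl
        _ ≤ 2 * ((4 * Real.pi)⁻¹ * Q) * Real.exp (-(‖ξ‖ ^ 2 / 4)) := this
        _ = 2 * Q * gaussVortexProfile ξ := by rw [gaussVortexProfile]; ring
    have h2 : ‖fderiv ℝ H ξ‖ ≤ Q * ‖ξ‖ * gaussVortexProfile ξ := by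
      rw [(hHd ξ).fderiv, norm_smul, innerSL_apply_norm, Real.norm_eq_abs, hρh_eq, abs_mul, abs_of_pos hG]
      have := hQ ξ
      nlinarith [norm_nonneg ξ, hG, abs_nonneg (q ξ), mul_nonneg hG.le (norm_nonneg ξ)]
    rw [pow_one]
    nlinarith [norm_nonneg ξ, hG, hQ0, mul_nonneg (mul_nonneg hQ0 hG.le) (norm_nonneg ξ)]
  -- weak divergence-freeness against `H`
  have hdiv : ∫ x, ⟪biotSavart2D wB x, gradient H x⟫ = 0 :=
    integral_inner_biotSavart2D_gradient_eq_zero_of_gaussClass 1 (3 * Q) (|C_B| * Bk) wB H hwBc hwBi hwBabs hH1 hHb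
  -- pointwise `⟪u_B, ∇H⟫ = G q ⟪ξ, u_B⟫`
  have hpt : ∀ ξ, gaussVortexProfile ξ * q ξ * ⟪ξ, biotSavart2D wB ξ⟫ = ⟪biotSavart2D wB ξ, gradient H ξ⟫ := by
    intro ξ
    rw [inner_gradient_right]
    simp only [RCLike.conj_to_real]
    rw [(hHd ξ).fderiv, _root_.smul_apply, innerSL_apply_apply, smul_eq_mul, hρh_eq, real_inner_comm]
  calc ∫ ξ, gaussVortexProfile ξ * q ξ * ⟪ξ, biotSavart2D wB ξ⟫ = ∫ ξ, ⟪biotSavart2D wB ξ, gradient H ξ⟫ :=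
        integral_congr_ae (Eventually.of_forall hpt)
    _ = 0 := hdiv

end Summit.AnomalousDissipation.AnomalousDissipation.Theorems.MarginalStabilityChainStretchedVortexRows

end
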